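import Summits.RiemannHypothesis.RiemannHypothesis.Theorems.JensenPolynomialsFarGumbelMoebiusDisc

/-!
# Route `JensenPolynomials`, FAR crux `XiWindowZeroFreeRelFar` (B1-rel far) — S3 WANTED item (L3), part 1b: the
SADDLE-DISC DICTIONARY for the descent (RH-FREE; cell rh-jensen, HUMAN RULING D-0040)

Item `stmt-RiemannHypothesis-19465`, stub S3 `stub_laplaceFar`, WANTED list v3 (HOME `eng-4/S3/S3-WANTED.lean`, sha16
`d6f8107cd04d985a`), item (L3) `wanted_descent` (file `JensenPolynomialsFarGumbelDescent.lean`). This file isolates what the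
descent needs to know about a point `u_s` of the saddle disc `‖u_s − (υ + ξ₀/4)‖ ≤ 1/(10υ²)` (`ξ₀ = farXi0 w (1/υ)`,
`w = farW (a/υ²)`, far mode `4πe^{4υ}υ = 2M + 9υ`, `υ ≥ 189/20`, `‖a‖ ≤ (9/25)υ²`), everything expressed through the ONE
real number `P := Re(π e^{4u_s})` (`= Λ·Re(w e^{κ})`, `κ = θ + 4(u_s − u₀)`, `Λ = farLam υ = πe^{4υ}`) and `q := u_s² + a`:

* `P ≥ (71/100)·Λ`;
* FIRST-ORDER CANCELLATION at the approximate saddle: `|9 − 4P + Re((2M−1)u_s/q)| ≤ 25 + (9/200)·P`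
  (this is `Re Ψ′(u_s) − Re(1/u_s)`; the `O(Λε)` terms cancel by the design of `ξ₀`, leaving
  `4Λ·w·[(1+εξ/4)/(1+σ) − e^{κ}]` with `‖(1+εξ/4) − (1+σ)e^{κ}‖ ≤ 91/10000`);
* `(M−½)/‖q‖ ≤ P/4` and `2‖u_s‖²(M−½)/‖q‖² ≤ (39/50)·P` (sizes of the second-order terms of `log‖u²+a‖`);
* `‖u_s − υ‖ ≤ 1/8`, `q ≠ 0`.

The coupling between `Re w` and `‖w‖` that makes the constants close is the MÖBIUS DISC `‖w − 625/544‖ ≤ 225/544`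
(`norm_farW_sub_center_le`: the image of `‖z̃‖ ≤ 9/25` under `z̃ ↦ (1+z̃)⁻¹`), whence `Re w ≥ 25/34`, `‖w‖ ≤ 25/16`,
`‖1/4 − w/2‖ ≤ 17/32` and `Re w ≥ 1/2 + (272/625)‖w‖²` (`farW_disc_facts`).
WHAT THIS IS NOT: elementary bookkeeping about an explicit phase function; nothing here bears on the zeros of `ζ` or RH.
-/

noncomputable section
-- D-0017: `Summit.RiemannHypothesis.RiemannHypothesis.…` duplicates the namespace BY DESIGN (single-problem summit).
set_option linter.dupNamespace false

namespace Summit.RiemannHypothesis.RiemannHypothesis.Theorems.JensenPolynomials.FarGumbel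

open Complex
open scoped Real

/-! ## The dictionary -/

set_option maxHeartbeats 800000 in -- one long chain of explicit `have`s (≈ 60 norm estimates); no search tactics
/-- **SADDLE-DISC DICTIONARY for (L3).** For the far mode `υ` (`4πe^{4υ}υ = 2M + 9υ`, `υ ≥ 189/20`), `‖a‖ ≤ (9/25)υ²`
and every `u_s` with `‖u_s − (υ + ξ₀/4)‖ ≤ 1/(10υ²)`, writing `P := Re(π e^{4u_s})` and `q := u_s² + a`:
`(71/100)Λ ≤ P`, `|9 − 4P + Re((2M−1)u_s/q)| ≤ 25 + (9/200)P`, `(M−½)/‖q‖ ≤ P/4`,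
`2‖u_s‖²(M−½)/‖q‖² ≤ (39/50)P`, `‖u_s − υ‖ ≤ 1/8`, `q ≠ 0`. -/
theorem descent_dictionary (M : ℕ) (υ : ℝ)
    (hυ : (189 / 20 : ℝ) ≤ υ ∧ 4 * Real.pi * Real.exp (4 * υ) * υ = 2 * (M : ℝ) + 9 * υ)
    (a : ℂ) (ha : ‖a‖ ≤ (9 / 25 : ℝ) * υ ^ 2) (u_s : ℂ)
    (hu : ‖u_s - ((υ : ℂ) + farXi0 (farW (a / (υ : ℂ) ^ 2)) (1 / υ) / 4)‖ ≤ 1 / (10 * υ ^ 2)) :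
    71 / 100 * farLam υ ≤ ((π : ℂ) * Complex.exp (4 * u_s)).re ∧
    |9 - 4 * ((π : ℂ) * Complex.exp (4 * u_s)).re + ((2 * (M : ℂ) - 1) * u_s / (u_s ^ 2 + a)).re| ≤
        25 + 9 / 200 * ((π : ℂ) * Complex.exp (4 * u_s)).re ∧
    ((M : ℝ) - 1 / 2) / ‖u_s ^ 2 + a‖ ≤ 1 / 4 * ((π : ℂ) * Complex.exp (4 * u_s)).re ∧
    2 * ‖u_s‖ ^ 2 * ((M : ℝ) - 1 / 2) / ‖u_s ^ 2 + a‖ ^ 2 ≤ 39 / 50 * ((π : ℂ) * Complex.exp (4 * u_s)).re ∧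
    ‖u_s - υ‖ ≤ 1 / 8 ∧ u_s ^ 2 + a ≠ 0 := by
  obtain ⟨hυ0, hmode⟩ := hυ
  have hυpos : 0 < υ := by linarith
  have hυne : (υ : ℂ) ≠ 0 := by exact_mod_cast hυpos.ne'
  have hυne' : υ ≠ 0 := hυpos.ne'
  have hυ2 : (89 : ℝ) ≤ υ ^ 2 := by nlinarith
  set Λ := farLam υ with hΛdef
  have hΛ9 : 9000000 ≤ Λ := farLam_ge_nine_million υ hυ0
  have hΛpos : 0 < Λ := by linarith
  -- `z̃` and the Möbius disc of `w`
  set z := a / (υ : ℂ) ^ 2 with hzdef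
  have hnυ2 : ‖(υ : ℂ) ^ 2‖ = υ ^ 2 := by
    rw [norm_pow, Complex.norm_real, Real.norm_eq_abs, abs_of_pos hυpos]
  have hz : ‖z‖ ≤ 9 / 25 := by
    rw [hzdef, norm_div, hnυ2, div_le_iff₀ (by positivity)]
    exact ha
  have haz : a = z * (υ : ℂ) ^ 2 := by
    rw [hzdef]; field_simp
  obtain ⟨hwre, hwn, hm, hcoup⟩ := farW_disc_facts hz
  set w := farW z with hwdef
  have h1z : 1 + z ≠ 0 := by
    intro h
    have h' : (1 + z).re = 0 := by rw [h]; simp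
    simp at h'
    linarith [(abs_le.mp (Complex.abs_re_le_norm z)).1]
  have hw' : w = (1 + z)⁻¹ := rfl
  have hw1z : w * (1 + z) = 1 := by rw [hw', inv_mul_cancel₀ h1z]
  have hw0 : w ≠ 0 := by
    intro h
    have : w.re = 0 := by rw [h]; simp
    linarith
  set n := ‖w‖ with hndef
  have hn_lo : 25 / 34 ≤ n := hwre.trans (Complex.re_le_norm w)
  have hn0 : 0 ≤ n := norm_nonneg w
  obtain ⟨hρ71, hn1, hn2⟩ := rho_coupling_aux hn_lo hwn
  -- `L = Log w`, `ε = 1/υ`, `m = 1/4 − w/2`, `θ = Lεm`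
  set L := Complex.log w with hLdef
  have hL : ‖L‖ ≤ 37 / 80 := norm_log_farW_le hz
  set ε : ℝ := 1 / υ with hεdef
  have hεpos : 0 < ε := by positivity
  have hε : ε ≤ 20 / 189 := by
    rw [hεdef, div_le_iff₀ hυpos]
    linarith
  have hυε : υ * ε = 1 := by rw [hεdef]; field_simp
  have hεC : (ε : ℂ) = (υ : ℂ)⁻¹ := by
    rw [hεdef]; push_cast; rw [one_div]
  have hεn : ‖(ε : ℂ)‖ = ε := by rw [Complex.norm_real, Real.norm_of_nonneg hεpos.le]
  set m : ℂ := 1 / 4 - w / 2 with hmdef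
  set θ : ℂ := L * ((ε : ℂ) * m) with hθdef
  have hξ0 : farXi0 w ε = L + θ := by
    rw [farXi0, hθdef, hmdef, hLdef]
    ring
  have hθ : ‖θ‖ ≤ 27 / 1000 := by
    rw [hθdef, norm_mul, norm_mul, hεn]
    calc ‖L‖ * (ε * ‖m‖) ≤ 37 / 80 * (20 / 189 * (17 / 32)) := by gcongr
      _ ≤ 27 / 1000 := by norm_num
  -- `d = u_s − u₀`, `κ = θ + 4d`, `ξ = L + κ = 4(u_s − υ)`
  set u₀ : ℂ := (υ : ℂ) + farXi0 w ε / 4 with hu0def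
  set d : ℂ := u_s - u₀ with hddef
  have hd : ‖d‖ ≤ 1 / 890 := by
    have h1 : 1 / (10 * υ ^ 2) ≤ (1 : ℝ) / 890 :=
      one_div_le_one_div_of_le (by norm_num) (by linarith only [hυ2])
    exact hu.trans h1
  set κ : ℂ := θ + 4 * d with hκdef
  have hκ : ‖κ‖ ≤ 4 / 125 := by
    have e4 : ‖(4 : ℂ) * d‖ = 4 * ‖d‖ := by rw [norm_mul]; norm_num
    calc ‖κ‖ ≤ ‖θ‖ + ‖4 * d‖ := norm_add_le _ _
      _ ≤ 27 / 1000 + 4 * (1 / 890) := by rw [e4]; gcongr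
      _ ≤ 4 / 125 := by norm_num
  set ξ : ℂ := L + κ with hξdef
  have hξ : ‖ξ‖ ≤ 1 / 2 := by
    calc ‖ξ‖ ≤ ‖L‖ + ‖κ‖ := norm_add_le _ _
      _ ≤ 37 / 80 + 4 / 125 := by gcongr
      _ ≤ 1 / 2 := by norm_num
  have hus : u_s = (υ : ℂ) + ξ / 4 := by
    have h1 : u_s = u₀ + d := by rw [hddef]; ring
    rw [h1, hu0def, hξ0, hξdef, hκdef]
    ring
  have husυ : ‖u_s - υ‖ ≤ 1 / 8 := by
    have e : u_s - υ = ξ / 4 := by rw [hus]; ring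
    have e4 : ‖(4 : ℂ)‖ = 4 := by simp
    rw [e, norm_div, e4]
    linarith
  -- `e^{κ} = 1 + κ + E₂`
  set E₂ : ℂ := Complex.exp κ - 1 - κ with hE2def
  have hE2 : ‖E₂‖ ≤ 16 / 15625 := by
    have h1 := Complex.norm_exp_sub_one_sub_id_le (x := κ) (by linarith [hκ])
    calc ‖E₂‖ ≤ ‖κ‖ ^ 2 := h1
      _ ≤ (4 / 125) ^ 2 := by gcongr
      _ = 16 / 15625 := by norm_num
  have hexpκ : Complex.exp κ = 1 + κ + E₂ := by rw [hE2def]; ring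
  have hexp1 : ‖Complex.exp κ - 1‖ ≤ 331 / 10000 := by
    have e : Complex.exp κ - 1 = E₂ + κ := by rw [hE2def]; ring
    rw [e]
    calc ‖E₂ + κ‖ ≤ ‖E₂‖ + ‖κ‖ := norm_add_le _ _
      _ ≤ 16 / 15625 + 4 / 125 := by gcongr
      _ ≤ 331 / 10000 := by norm_num
  -- KEY identity `π e^{4u_s} = Λ · w e^{κ}`, and `P`
  have hkey : (π : ℂ) * Complex.exp (4 * u_s) = (Λ : ℂ) * (w * Complex.exp κ) := by
    have h4u : 4 * u_s = ((4 * υ : ℝ) : ℂ) + L + κ := by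
      rw [hus, hξdef]
      push_cast
      ring
    rw [h4u, Complex.exp_add, Complex.exp_add, hLdef, Complex.exp_log hw0]
    simp only [hΛdef, farLam]
    push_cast
    ring
  set P : ℝ := ((π : ℂ) * Complex.exp (4 * u_s)).re with hPdef
  have hP : P = Λ * (w * Complex.exp κ).re := by rw [hPdef, hkey, Complex.re_ofReal_mul]
  -- the `ρ`-lower bound in terms of `n = ‖w‖`
  set ρl : ℝ := 1 / 2 + 272 / 625 * n ^ 2 - 331 / 10000 * n with hρldef
  have hρ : ρl ≤ (w * Complex.exp κ).re := by
    have e : w * Complex.exp κ = w + w * (Complex.exp κ - 1) := by ring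
    rw [e, Complex.add_re]
    have h1 := (abs_le.mp (Complex.abs_re_le_norm (w * (Complex.exp κ - 1)))).1
    have h2 : ‖w * (Complex.exp κ - 1)‖ ≤ n * (331 / 10000) := by
      rw [norm_mul]
      exact mul_le_mul_of_nonneg_left hexp1 (norm_nonneg _)
    rw [hρldef]
    linarith [hcoup, h1, h2]
  have hρlpos : 0 < ρl := by linarith
  have hΛρ : Λ * ρl ≤ P := by
    rw [hP]
    exact mul_le_mul_of_nonneg_left hρ hΛpos.le
  have hPpos : 0 < P := lt_of_lt_of_le (mul_pos hΛpos hρlpos) hΛρ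
  have hA1 : 71 / 100 * Λ ≤ P := by
    have h1 := mul_le_mul_of_nonneg_left hρ71 hΛpos.le
    linarith
  have hΛn : Λ * n ≤ 28 / 25 * P := by
    have h1 := mul_le_mul_of_nonneg_left hn1 hΛpos.le
    linarith
  have hΛn2 : Λ * n ^ 2 ≤ 163 / 100 * P := by
    have h1 := mul_le_mul_of_nonneg_left hn2 hΛpos.le
    linarith
  -- `σ` and `q = u_s² + a = υ²(1+z̃)(1+σ)`
  set σ : ℂ := w * ((ε : ℂ) * ξ / 2 + (ε : ℂ) ^ 2 * ξ ^ 2 / 16) with hσdef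
  have hσ : ‖σ‖ ≤ 21 / 500 := by
    rw [hσdef, norm_mul]
    have e2 : ‖(2 : ℂ)‖ = 2 := by simp
    have e16 : ‖(16 : ℂ)‖ = 16 := by simp
    have h1 : ‖(ε : ℂ) * ξ / 2 + (ε : ℂ) ^ 2 * ξ ^ 2 / 16‖ ≤
        20 / 189 * (1 / 2) / 2 + (20 / 189) ^ 2 * (1 / 2) ^ 2 / 16 := by
      calc ‖(ε : ℂ) * ξ / 2 + (ε : ℂ) ^ 2 * ξ ^ 2 / 16‖
          ≤ ‖(ε : ℂ) * ξ / 2‖ + ‖(ε : ℂ) ^ 2 * ξ ^ 2 / 16‖ := norm_add_le _ _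
        _ = ε * ‖ξ‖ / 2 + ε ^ 2 * ‖ξ‖ ^ 2 / 16 := by
            rw [norm_div, norm_div, norm_mul, norm_mul, norm_pow, norm_pow, hεn, e2, e16]
        _ ≤ 20 / 189 * (1 / 2) / 2 + (20 / 189) ^ 2 * (1 / 2) ^ 2 / 16 := by gcongr
    calc ‖w‖ * ‖(ε : ℂ) * ξ / 2 + (ε : ℂ) ^ 2 * ξ ^ 2 / 16‖
        ≤ 25 / 16 * (20 / 189 * (1 / 2) / 2 + (20 / 189) ^ 2 * (1 / 2) ^ 2 / 16) := by gcongr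
      _ ≤ 21 / 500 := by norm_num
  set q : ℂ := u_s ^ 2 + a with hqdef
  have hq : q = (υ : ℂ) ^ 2 * (1 + z) * (1 + σ) := by
    have h1 := sq_add_identity_aux (υ : ℂ) ξ z hυne h1z
    rw [hqdef, hus, haz, hσdef, hw', hεC]
    linear_combination h1
  have h1σ : 479 / 500 ≤ ‖1 + σ‖ := by
    have h1 := norm_sub_norm_le (1 : ℂ) (-σ)
    rw [sub_neg_eq_add, norm_one, norm_neg] at h1
    linarith
  have h1σ0 : 1 + σ ≠ 0 := by
    intro h
    rw [h, norm_zero] at h1σ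
    linarith
  have hq0 : q ≠ 0 := by
    rw [hq]
    exact mul_ne_zero (mul_ne_zero (pow_ne_zero 2 hυne) h1z) h1σ0
  have hqpos : 0 < ‖q‖ := norm_pos_iff.mpr hq0
  have hnq : 479 / 500 * υ ^ 2 ≤ n * ‖q‖ := by
    have h1 : n * ‖1 + z‖ = 1 := by rw [hndef, ← norm_mul, hw1z, norm_one]
    rw [hq, norm_mul, norm_mul, hnυ2]
    calc 479 / 500 * υ ^ 2 = υ ^ 2 * (n * ‖1 + z‖) * (479 / 500) := by rw [h1]; ring
      _ ≤ υ ^ 2 * (n * ‖1 + z‖) * ‖1 + σ‖ := by rw [h1]; gcongr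
      _ = n * (υ ^ 2 * ‖1 + z‖ * ‖1 + σ‖) := by ring
  -- `M − ½ = 2Λυ − (9υ+1)/2`
  have hT : (M : ℝ) - 1 / 2 = 2 * Λ * υ - (9 * υ + 1) / 2 := by
    simp only [hΛdef, farLam]
    linarith
  have hΛυ : 9000000 * υ ≤ Λ * υ := mul_le_mul_of_nonneg_right hΛ9 hυpos.le
  have hT_le : (M : ℝ) - 1 / 2 ≤ 2 * Λ * υ := by rw [hT]; linarith
  have hT0 : 0 ≤ (M : ℝ) - 1 / 2 := by rw [hT]; linarith
  -- (A3) `(M−½)/‖q‖ ≤ P/4`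
  have hA3 : ((M : ℝ) - 1 / 2) / ‖q‖ ≤ 1 / 4 * P := by
    rw [div_le_iff₀ hqpos]
    have h2 : Λ * (25 / 28) * (479 / 500 * υ ^ 2) ≤ P * ‖q‖ := by
      calc Λ * (25 / 28) * (479 / 500 * υ ^ 2) ≤ Λ * (25 / 28) * (n * ‖q‖) := by gcongr
        _ = 25 / 28 * (Λ * n) * ‖q‖ := by ring
        _ ≤ 25 / 28 * (28 / 25 * P) * ‖q‖ := by gcongr
        _ = P * ‖q‖ := by ring
    have h3 : (2 : ℝ) ≤ 1 / 4 * (25 / 28) * (479 / 500) * υ := by linarith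
    have h4 : 2 * (Λ * υ) ≤ 1 / 4 * (25 / 28) * (479 / 500) * υ * (Λ * υ) :=
      mul_le_mul_of_nonneg_right h3 (by positivity)
    calc (M : ℝ) - 1 / 2 ≤ 2 * Λ * υ := hT_le
      _ = 2 * (Λ * υ) := by ring
      _ ≤ 1 / 4 * (25 / 28) * (479 / 500) * υ * (Λ * υ) := h4
      _ = 1 / 4 * (Λ * (25 / 28) * (479 / 500 * υ ^ 2)) := by ring
      _ ≤ 1 / 4 * (P * ‖q‖) := by gcongr
      _ = 1 / 4 * P * ‖q‖ := by ring
  -- (A4) `2‖u_s‖²(M−½)/‖q‖² ≤ (39/50)P`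
  have hun : ‖u_s‖ ≤ υ + 1 / 8 := by
    have h1 := norm_add_le (u_s - υ) (υ : ℂ)
    rw [sub_add_cancel, Complex.norm_real, Real.norm_of_nonneg hυpos.le] at h1
    linarith
  have hun' : ‖u_s‖ ≤ 383 / 378 * υ := by linarith
  have hA4 : 2 * ‖u_s‖ ^ 2 * ((M : ℝ) - 1 / 2) / ‖q‖ ^ 2 ≤ 39 / 50 * P := by
    rw [div_le_iff₀ (by positivity)]
    have h2 : (479 / 500 * υ ^ 2) ^ 2 ≤ (n * ‖q‖) ^ 2 := pow_le_pow_left₀ (by positivity) hnq 2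
    have h3 : Λ * (100 / 163) * (479 / 500 * υ ^ 2) ^ 2 ≤ P * ‖q‖ ^ 2 := by
      calc Λ * (100 / 163) * (479 / 500 * υ ^ 2) ^ 2 ≤ Λ * (100 / 163) * (n * ‖q‖) ^ 2 := by gcongr
        _ = 100 / 163 * (Λ * n ^ 2) * ‖q‖ ^ 2 := by ring
        _ ≤ 100 / 163 * (163 / 100 * P) * ‖q‖ ^ 2 := by gcongr
        _ = P * ‖q‖ ^ 2 := by ring
    have h5 : 4 * (383 / 378 : ℝ) ^ 2 ≤ 39 / 50 * (100 / 163) * (479 / 500) ^ 2 * υ := by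
      linarith
    have h6 := mul_le_mul_of_nonneg_right h5 (by positivity : (0 : ℝ) ≤ Λ * υ ^ 3)
    calc 2 * ‖u_s‖ ^ 2 * ((M : ℝ) - 1 / 2) ≤ 2 * (383 / 378 * υ) ^ 2 * (2 * Λ * υ) := by
          gcongr
      _ = 4 * (383 / 378 : ℝ) ^ 2 * (Λ * υ ^ 3) := by ring
      _ ≤ 39 / 50 * (100 / 163) * (479 / 500) ^ 2 * υ * (Λ * υ ^ 3) := h6
      _ = 39 / 50 * (Λ * (100 / 163) * (479 / 500 * υ ^ 2) ^ 2) := by ring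
      _ ≤ 39 / 50 * (P * ‖q‖ ^ 2) := by gcongr
      _ = 39 / 50 * P * ‖q‖ ^ 2 := by ring
  -- (A2) the first-order cancellation
  have h2M : (2 * (M : ℂ) - 1) = (υ : ℂ) * (((4 * Λ - 9 - ε : ℝ)) : ℂ) := by
    have e1 : (2 * (M : ℝ) - 1) = υ * (4 * Λ - 9 - ε) := by
      have e2 : (2 * (M : ℝ) - 1) = 4 * Λ * υ - 9 * υ - 1 := by
        simp only [hΛdef, farLam]
        linarith
      rw [e2]
      linear_combination hυε
    calc (2 * (M : ℂ) - 1) = ((2 * (M : ℝ) - 1 : ℝ) : ℂ) := by push_cast; ring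
      _ = (υ : ℂ) * (((4 * Λ - 9 - ε : ℝ)) : ℂ) := by rw [e1]; push_cast; ring
  set V : ℂ := (1 + (ε : ℂ) * ξ / 4) * w / (1 + σ) with hVdef
  have hVeq : (2 * (M : ℂ) - 1) * u_s / q = (((4 * Λ - 9 - ε : ℝ)) : ℂ) * V := by
    have h1 := lin_identity_aux (υ : ℂ) ξ z σ (((4 * Λ - 9 - ε : ℝ)) : ℂ) hυne h1z h1σ0
    rw [h2M, hq, hVdef, hus, hw', hεC]
    linear_combination h1
  have hVn : ‖V‖ ≤ 5 / 3 := by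
    rw [hVdef, norm_div, norm_mul, div_le_iff₀ (by linarith)]
    have e4 : ‖(4 : ℂ)‖ = 4 := by simp
    have h1 : ‖1 + (ε : ℂ) * ξ / 4‖ ≤ 1 + 20 / 189 * (1 / 2) / 4 := by
      calc ‖1 + (ε : ℂ) * ξ / 4‖ ≤ ‖(1 : ℂ)‖ + ‖(ε : ℂ) * ξ / 4‖ := norm_add_le _ _
        _ = 1 + ε * ‖ξ‖ / 4 := by rw [norm_one, norm_div, norm_mul, hεn, e4]
        _ ≤ 1 + 20 / 189 * (1 / 2) / 4 := by gcongr
    calc ‖1 + (ε : ℂ) * ξ / 4‖ * ‖w‖ ≤ (1 + 20 / 189 * (1 / 2) / 4) * (25 / 16) := by gcongr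
      _ ≤ 5 / 3 * (479 / 500) := by norm_num
      _ ≤ 5 / 3 * ‖1 + σ‖ := by gcongr
  set N : ℂ := (1 + (ε : ℂ) * ξ / 4) - (1 + σ) * Complex.exp κ with hNdef
  have hVsub : V - w * Complex.exp κ = w * N / (1 + σ) := by
    rw [hVdef, hNdef]
    field_simp
  have hNeq : N = θ * ((ε : ℂ) * m) - 4 * d * (1 - (ε : ℂ) * m) - w * ((ε : ℂ) ^ 2 * ξ ^ 2 / 16)
      - σ * κ - (1 + σ) * E₂ := by
    have h1 := cancel_identity_aux L m d w E₂ (ε : ℂ) κ hmdef (by rw [hκdef, hθdef])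
    rw [hNdef, hexpκ, hσdef, hξdef, hθdef]
    linear_combination h1
  have hN : ‖N‖ ≤ 91 / 10000 := by
    rw [hNeq]
    exact cancel_norm_aux hεpos.le hε hθ hm hd hwn hξ hσ hκ hE2
  have hwN : ‖w * N / (1 + σ)‖ ≤ n * (1 / 100) := by
    rw [norm_div, norm_mul, div_le_iff₀ (by linarith)]
    calc ‖w‖ * ‖N‖ ≤ n * (91 / 10000) := by gcongr
      _ ≤ n * (1 / 100) * (479 / 500) := by nlinarith [hn0]
      _ ≤ n * (1 / 100) * ‖1 + σ‖ := by gcongr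
  have hβeq : 9 - 4 * P + ((2 * (M : ℂ) - 1) * u_s / q).re =
      9 - (9 + ε) * V.re + 4 * Λ * (w * N / (1 + σ)).re := by
    rw [hVeq, Complex.re_ofReal_mul, ← hVsub, Complex.sub_re, hP]
    ring
  have hA2 : |9 - 4 * P + ((2 * (M : ℂ) - 1) * u_s / q).re| ≤ 25 + 9 / 200 * P := by
    rw [hβeq]
    have h1 : |V.re| ≤ 5 / 3 := (Complex.abs_re_le_norm V).trans hVn
    have h2 : |(w * N / (1 + σ)).re| ≤ n * (1 / 100) := (Complex.abs_re_le_norm _).trans hwN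
    have h4 : |(9 + ε) * V.re| ≤ (9 + 20 / 189) * (5 / 3) := by
      rw [abs_mul, abs_of_pos (by linarith)]
      exact mul_le_mul (by linarith) h1 (abs_nonneg _) (by linarith)
    have h5 : |4 * Λ * (w * N / (1 + σ)).re| ≤ 4 * Λ * (n * (1 / 100)) := by
      rw [abs_mul, abs_of_pos (by positivity)]
      exact mul_le_mul_of_nonneg_left h2 (by positivity)
    obtain ⟨h4a, h4b⟩ := abs_le.mp h4
    obtain ⟨h5a, h5b⟩ := abs_le.mp h5
    rw [abs_le]
    constructor <;> linarith [h4a, h4b, h5a, h5b, hΛn]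
  exact ⟨hA1, hA2, hA3, hA4, husυ, hq0⟩

end Summit.RiemannHypothesis.RiemannHypothesis.Theorems.JensenPolynomials.FarGumbel

end
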